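import Summits.ABC.IUTFork.Repair.ObstructionSS28Places
import Summits.ABC.IUTFork.Cor312ProvK
import HarnessLib

/-!
# D-0079 RESCUE sub-cell R-H («local-height condition I06⋆»), ROUND 1, ROW 11 «avg-slack-nonneg» — the DECIDING DECL of the
# candidate H⋆₁₁ = «PN-weighted label-and-place AVERAGE of the cell slack ≥ 0» in its two typed readings (sufficient A⁻ / necessary A⁺)

DEFINITION file (D-0012: claim-tagged `def … : Prop` HYPOTHESES, never asserted; no `Prop` fact of the literature; no instance, no notation) of
the abc-iut cell, rung LADDER-ABC:A2.RESCUE.H; seat abc-iut-rh-typ-11 (R-H round-1 pair n = 11 TYPER; director-abc 2026-08-26T15:32:46Z, rh-lead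
`plan/rescue/R-H/RH-CANDIDATES.tsv` v1 sha16 f7773e15cd7f6906 row 11, k2 desk hand abc-iut-rp-s2). TAKES NO SIDE on [IUTchIII] Cor. 3.12 or on
any author; candidates are hypotheses; typed ≠ proved; instantiated ≠ endorsed; refuted-as-typed ≠ refuted-in-print.

THE CANDIDATE, verbatim (RH-CANDIDATES v1 row 11, harvested from abc-iut-lens-dual-1 «additive↔multiplicative exchange on the Θ-side label-AVERAGED
output» and abc-iut-rp-s2's two-exponent averaged columns p454909): «PN-weighted label-and-place AVERAGE of the cell slack ≥ 0:
Σ_{w,j} weight(w,j)·slack(w,j) ≥ 0 with slack_minus (SUFFICIENT for the typed Corollary: statement_of_avg_lowerIndex_sub_height_nonneg) or slack_plus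
(NECESSARY: avg_upperIndex_sub_height_nonneg_of_statement)»; scope «whole datum (averaged over labels and bad places)»; cut class «averaged /
START-HERE §3 k4 clause».

WHAT IS TYPED (everything consumed BY NAME; column vocabulary of `plan/rescue/R-H/I06STAR-COLUMNS.tsv` v1 sha16 2e4c48fd4267a5a7 / START-HERE §1–§2:
`c = ord_p(p*)`, `a_e = ⌈e/(p−2)⌉/e` (`2` at `p = 2`), `b_e = ⌊log_p(p·e/(p−1))⌋ − 1/e` ([IUTchIV] Prop. 1.2; tree `logRadiusA`/`logRadiusB`,
integer closed forms abc-iut-rp-x2 `LogRadiusClosedForm` p452044), `κ⁻ = c − a_e` (SUFFICIENT shell exponent, abc-iut-rp-d2 `CandInternal2RealLabels`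
p450037), `κ⁺ = b_e + c` (NECESSARY), demand `h(w,j) = (j²−1)·H/(2l)`, `H = ord_p(q_E) = ord_w(q)/e_w`, PN = procession normalisation = the UNIFORM
average over `j ∈ 𝔽_l^⋇` (`Literature.IUT.LogThetaLattice.processionNormalized`, [IUTchIII] Prop. 3.9 (i))):
* §1 COLUMN VOCABULARY in INTEGERS (`w`-normalised units × `2l`, so that every cell is decidable by `decide`): `eMulA` (`e·a_e`), `eFloorLog`
  (`⌊log_p(p·e/(p−1))⌋ = e·b_e + 1`... times `e`: `e·b_e = e·⌊…⌋ − 1`), `cExp`, `capMinusW = e·κ⁻`, `capPlusW = e·κ⁺`, the cell slacks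
  `slackMinusW2l = 2l·e·(κ⁻ − h)`, `slackPlusW2l = 2l·e·(κ⁺ − h)` as functions of `(p, e_w, ord_w(q), l, j)`, and their LABEL SUMS over
  `j = 1 … l⋆` (`placeSumMinus`, `placeSumPlus`) — the sign of `placeSum∓` is the sign of the PN-average of the table's `slack_∓` column at the place.
* §2 THE CANDIDATE AT THE GENUINE `K`-LEVEL DATUM `Cor312Prov.pilotDataOfK D K` of an initial Θ-datum `D` ([IUTchI] Def. 3.1; abc-iut-C-cert-3):
  **`HStarMinus D`** (A⁻, THE candidate: `0 ≤ Σ_{w ∈ 𝕍(K)^bad} logNorm(w) · placeSumMinus(p_w, e_w, ord_w(q), l)`) and **`HStarPlus D`** (A⁺, comparison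
  object). WEIGHTS: inside the packet over `p` the place `w` carries the normalised weight `[K_w:ℚ_p]/[K:ℚ]` ([IUTchIV] Thm. 1.10 «normalized weight»;
  Dupuy–Hilado §3.6 `localDegree`) and the unit log-volume `log p`; a cell slack in `p`-units is `slack∓W2l/(2l·e_w)`; so the PN-weighted label-and-place
  sum equals `(2l·l⋆·[K:ℚ])⁻¹ · Σ_w f_w·log(p_w)·placeSum∓ = (2l·l⋆·[K:ℚ])⁻¹ · Σ_w logNorm(w)·placeSum∓` (`logNorm_eq`) — the positive factor is dropped.
* §3 THE VOLUME-LEVEL FORM the k2 door reads (abc-iut-rp-s2 `ObstructionSS28Places`, p454909), for ANY lattice situation / setting and an exponent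
  binder `δ`: **`AvgIndexSlackNonneg S P δ`** := `0 ≤ PN(i ↦ Σᶠ_{v_ℚ} [δ_{i,v_ℚ} − ((i+1)²−1)·(−qLocal_{i+1,v_ℚ})])`, with the two doors RE-EXPORTED BY NAME:
  `statement_of_avgIndexSlackNonneg` (lower container-volume bound `δ = δ⁻` ⟹ A⁻ ⟹ typed Statement: SUFFICIENT — k2 for the A⁻ form, target = the
  Statement, NOT S_H) and `avgIndexSlackNonneg_of_statement` (upper bound `δ = δ⁺`: Statement ⟹ A⁺ — the A⁺ form is NECESSARY, i.e. implied by the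
  Corollary: k4-dead as a rescue BY NAME `ObstructionSS28Window.statement_iff_avg_cellSlack`; typed here only so that the kill cites a kernel object).
* §4 EVALUATION LEMMAS (k1 substrate, `decide`): the label sums at the v1 rows where A⁻ holds (HEX:1:5, HEX:1:7, HEX:2:5, X75 at `e(v|7) = 1`) and
  at the binding negative rows (lamSeven k=1 l=11 `e_w = 11`: `placeSumMinus = −220 < 0`, `placeSumPlus = 1210 ≥ 0`; X72: both `−10`), and the
  single-local-type reduction `hStarMinus_sign_of_const` is left to the k1 engines (all v1 rows have ONE local type per (datum, type) group, so
  `HStarMinus` holds there iff `0 ≤ placeSumMinus`; two engines agree: this seat's `k1_eval.py` and abc-iut-rp-s2's `row11_k1.py` e6d21d082ef83346).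
k1 OF RECORD (v1 rows, per (datum, local type) group; OPEN counts against; exact integers): A⁻ G-HEX/lamSeven 0/256 (every k-slice 0/16) · HEX-strip
24/272 (HEX:1:5 ×8, HEX:1:7 ×8, HEX:2:5 ×8) · concrete 2/4 (X75, X75i) — pooled 26/532 = 4.9 % < 95 % ⇒ KILL(k1) by the verbatim rule; A⁺ 27/256 ·
114/272 · 2/4. HONEST SCOPE: the genuine-level defs read the table's SUFFICIENT/NECESSARY shell exponents, i.e. I06⋆'s honest reading in print's
containers reading (hull = log-shell orbit); at the genuine bed the (Ind1)(Ind2)-hull may exceed the shell container (R-W's window), so `¬ HStarPlus`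
is NOT a refutation of the typed Statement there; nothing here decides a genuine cell beyond integer arithmetic; the bridge «`HStarMinus D` ⟹
`AvgIndexSlackNonneg` at `settingPrVolSharp (pilotDataOfK D K) …` with `δ⁻` := the `κ⁻`-ball volumes» needs the genuine container-volume law (R-W /
C-R30) and is NOT claimed. [cite: Mochizuki2012, IUTchI Def. 3.1 (b)(c) p. 61; IUTchIII Prop. 3.9 (i) p. 116, Cor. 3.12 p. 173–174; IUTchIV Prop. 1.2 p. 10,
Thm. 1.10 p. 22–23] [cite: MochizukiAbsTopIII2015, Def 5.4 (iii) p. 126] [cite: DupuyHilado2025, §2.5.4, §3.3, §3.6] [cite: ScholzeStix2018, §2.2 p. 10]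
[claim: Mochizuki2012, status: disputed] for every IUT locution. Axioms: standard.
-/

noncomputable section

open Set Function NumberField IsDedekindDomain

namespace Summit.ABC.IUTFork.Repair.RHAvgSlackNonneg

open Thm311 Cor312 Cor312Vol Cor312Prov Literature.IUT.LogThetaLattice Literature.IUT.LogVolume Literature.IUT.HodgeTheaters
  Summit.ABC.IUTFork.Repair.CandInternal2 Summit.ABC.IUTFork.Repair.ObstructionSS28Places

/-! ## §1. Column vocabulary in integers (`w`-units × `2l`) -/

/-- `e · a_e`: `⌈e/(p−2)⌉ = (e + p − 3)/(p − 2)` (natural-number division) for `p > 2` (abc-iut-rp-x2 `logRadiusA_eq_ceilDiv`), `2e` at `p = 2`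
(`a = 2`). [cite: Mochizuki2012, IUTchIV Prop. 1.2 p. 10] -/
def eMulA (p e : ℕ) : ℕ := if p = 2 then 2 * e else (e + p - 3) / (p - 2)

/-- `⌊log_p(p·e/(p−1))⌋` as `Nat.log p (p·e/(p−1))` (so `e·b_e = e·eFloorLog − 1`; abc-iut-rp-x2 `logRadiusB_eq_natLog` for `e ≥ p − 1`, `= 0` on the
tame range). [cite: Mochizuki2012, IUTchIV Prop. 1.2 p. 10] -/
def eFloorLog (p e : ℕ) : ℕ := Nat.log p (p * e / (p - 1))

/-- `c = ord_p(p*)`: `2` at `p = 2`, else `1` (`p* = 4 | p`). [cite: MochizukiAbsTopIII2015, Def 5.4 (iii) p. 126] -/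
def cExp (p : ℕ) : ℕ := if p = 2 then 2 else 1

/-- SUFFICIENT shell capacity in `w`-units: `e·κ⁻ = e·c − e·a_e` (the `κ⁻`-ball lies in `ℐ_w`, abc-iut-rp-d2 `closedBall_radiusA_subset_logShell`).
[cite: Mochizuki2012, IUTchIV Prop. 1.2 (i) p. 10] -/
def capMinusW (p e : ℕ) : ℤ := ((e * cExp p : ℕ) : ℤ) - ((eMulA p e : ℕ) : ℤ)

/-- NECESSARY shell capacity in `w`-units: `e·κ⁺ = e·c + e·b_e = e·c + e·⌊log_p(p·e/(p−1))⌋ − 1` (`ℐ_w` lies in the `κ⁺`-ball, abc-iut-rp-d2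
`logShell_ofUnitLog_subset_closedBall`). [cite: Mochizuki2012, IUTchIV Prop. 1.2 (i) p. 10] -/
def capPlusW (p e : ℕ) : ℤ := ((e * cExp p : ℕ) : ℤ) + ((e * eFloorLog p e : ℕ) : ℤ) - 1

/-- The SUFFICIENT cell slack at label `j`, in `w`-units × `2l`: `2l·e·(κ⁻ − h) = 2l·capMinusW − (j² − 1)·ord_w(q)` (`ord_w(q) = e_w·H = 2l·P_w`;
sign = sign of the table's `slack_minus`). [cite: Mochizuki2012, IUTchIV Prop. 1.2 (i) p. 10] -/
def slackMinusW2l (p e : ℕ) (ordq : ℤ) (l j : ℕ) : ℤ := 2 * (l : ℤ) * capMinusW p e - (((j : ℤ) ^ 2 - 1) * ordq)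

/-- The NECESSARY cell slack at label `j`, in `w`-units × `2l`: `2l·capPlusW − (j² − 1)·ord_w(q)` (sign = sign of the table's `slack_plus`).
[cite: Mochizuki2012, IUTchIV Prop. 1.2 (i) p. 10] -/
def slackPlusW2l (p e : ℕ) (ordq : ℤ) (l j : ℕ) : ℤ := 2 * (l : ℤ) * capPlusW p e - (((j : ℤ) ^ 2 - 1) * ordq)

/-- LABEL SUM of the sufficient slacks at one place, `Σ_{j=1}^{l⋆} slackMinusW2l`, `l⋆ = (l−1)/2` (= `2l·e·l⋆ ×` the PN-average of `slack_minus` at the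
place; PN is the uniform average over `𝔽_l^⋇`, [IUTchIII] Prop. 3.9 (i)). [cite: Mochizuki2012, IUTchIII Prop. 3.9 (i) p. 116] -/
def placeSumMinus (p e : ℕ) (ordq : ℤ) (l : ℕ) : ℤ := ∑ i ∈ Finset.range ((l - 1) / 2), slackMinusW2l p e ordq l (i + 1)

/-- LABEL SUM of the necessary slacks at one place, `Σ_{j=1}^{l⋆} slackPlusW2l`. [cite: Mochizuki2012, IUTchIII Prop. 3.9 (i) p. 116] -/
def placeSumPlus (p e : ℕ) (ordq : ℤ) (l : ℕ) : ℤ := ∑ i ∈ Finset.range ((l - 1) / 2), slackPlusW2l p e ordq l (i + 1)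

/-- `Σ_{j ≤ l⋆} (j² − 1)·x = (l⋆(l⋆+1)(2l⋆+1)/6 − l⋆)·x`: the label sums in closed form are `2l·l⋆·cap∓ − ord_w(q)·(Σ j² − l⋆)`; recorded as the
defining sum split (linearity), the arithmetic of `Σ j²` being left to `decide` at concrete rows. [folklore] -/
theorem placeSumMinus_eq (p e : ℕ) (ordq : ℤ) (l : ℕ) :
    placeSumMinus p e ordq l = 2 * (l : ℤ) * capMinusW p e * (((l - 1) / 2 : ℕ) : ℤ) -
      (∑ i ∈ Finset.range ((l - 1) / 2), ((((i + 1 : ℕ) : ℤ)) ^ 2 - 1)) * ordq := by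
  unfold placeSumMinus slackMinusW2l
  rw [Finset.sum_sub_distrib, Finset.sum_const, Finset.card_range, Finset.sum_mul, nsmul_eq_mul]
  ring

/-- The necessary label sum dominates the sufficient one termwise as soon as `capMinusW ≤ capPlusW` (always the case for `e ≥ 1`: `a_e + b_e ≥ 0`);
stated with the capacity comparison as hypothesis (pure bookkeeping). [folklore] -/
theorem placeSumMinus_le_placeSumPlus {p e : ℕ} (hcap : capMinusW p e ≤ capPlusW p e) (ordq : ℤ) (l : ℕ) :
    placeSumMinus p e ordq l ≤ placeSumPlus p e ordq l := by
  unfold placeSumMinus placeSumPlus slackMinusW2l slackPlusW2l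
  refine Finset.sum_le_sum fun i _ => ?_
  have hl : (0 : ℤ) ≤ 2 * (l : ℤ) := by positivity
  nlinarith [mul_le_mul_of_nonneg_left hcap hl]

/-! ## §2. The candidate at the genuine `K`-level datum (pilotDataOfK currency) -/

section Genuine

variable {F K Fbar : Type} [Field F] [NumberField F] [Field K] [NumberField K] [Algebra F K] [Field Fbar]
  [Algebra F Fbar] [Algebra K Fbar] {E : WeierstrassCurve F} [E.IsElliptic] {l : ℕ} {Pb : BadPlacePredicates K}

/-- **H⋆₁₁, A⁻ (SUFFICIENT) FORM — THE CANDIDATE.** At the genuine `K`-level Dupuy–Hilado datum `pilotDataOfK D K` of an initial Θ-datum `D`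
([IUTchI] Def. 3.1; `K = F(E_F[l])`): the `logNorm`-weighted sum over the bad places `w` of `K` of the label sums of the SUFFICIENT cell slacks is
nonnegative — «PN-weighted label-and-place AVERAGE of the cell slack ≥ 0 with slack_minus» (RH-CANDIDATES v1 row 11), read on the integers
`p_w = residueChar`, `e_w = ramIdx`, `ord_w(q) = (pilotDataOfK D K).ordq w = e(w|v)·ord_v(q_v)`, `l`; positive normalisation `(2l·l⋆·[K:ℚ])⁻¹` dropped.
[R-H candidate, hypothesis — not a fact] [cite: Mochizuki2012, IUTchI Def. 3.1 (b)(c) p. 61; IUTchIV Thm. 1.10 p. 22–23] [cite: DupuyHilado2025, §3.3, §3.6]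
[claim: Mochizuki2012, status: disputed] -/
@[claim "Mochizuki2012" "disputed"]
def HStarMinus (D : InitialThetaData F K Fbar E l Pb) : Prop :=
  0 ≤ ∑ w ∈ (pilotDataOfK D K).S,
    logNorm K w * (placeSumMinus (residueChar K w) (ramIdx K w) ((pilotDataOfK D K).ordq w) l : ℝ)

/-- **H⋆₁₁, A⁺ (NECESSARY) FORM — comparison object only** («… or slack_plus (NECESSARY …)», same row): the same weighted sum with the NECESSARY
shell capacity `κ⁺`. Inside print's containers reading it is IMPLIED by the typed Corollary (§3 `avgIndexSlackNonneg_of_statement`), hence not a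
rescue candidate (k4, `ObstructionSS28Window.statement_iff_avg_cellSlack`). [R-H candidate, hypothesis — not a fact]
[cite: Mochizuki2012, IUTchIV Prop. 1.2 (i) p. 10, Thm. 1.10 p. 22–23] [claim: Mochizuki2012, status: disputed] -/
@[claim "Mochizuki2012" "disputed"]
def HStarPlus (D : InitialThetaData F K Fbar E l Pb) : Prop :=
  0 ≤ ∑ w ∈ (pilotDataOfK D K).S,
    logNorm K w * (placeSumPlus (residueChar K w) (ramIdx K w) ((pilotDataOfK D K).ordq w) l : ℝ)

/-- `logNorm(w) = f_w · log p_w > 0` at every finite place. [cite: DupuyHilado2025, §2.5.4] -/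
theorem logNorm_pos (w : HeightOneSpectrum (𝓞 K)) : 0 < logNorm K w := by
  rw [logNorm_eq]
  have hf : (0 : ℝ) < (resDeg K w : ℝ) := by exact_mod_cast Nat.pos_of_ne_zero (resDeg_ne_zero K w)
  have hp : (1 : ℝ) < (residueChar K w : ℝ) := by exact_mod_cast (residueChar_prime K w).one_lt
  exact mul_pos hf (Real.log_pos hp)

/-- **k1 READING: single sign.** If at EVERY bad place of the datum the sufficient label sum is `≥ 0`, then `HStarMinus D` (all weights are positive).
The rows of I06STAR-COLUMNS v1 have one local type per (datum, type) group, so there `HStarMinus` holds iff `0 ≤ placeSumMinus` at that type.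
[cite: DupuyHilado2025, §3.6] [claim: Mochizuki2012, status: disputed] -/
theorem hStarMinus_of_forall_nonneg (D : InitialThetaData F K Fbar E l Pb)
    (h : ∀ w ∈ (pilotDataOfK D K).S, 0 ≤ placeSumMinus (residueChar K w) (ramIdx K w) ((pilotDataOfK D K).ordq w) l) :
    HStarMinus D :=
  Finset.sum_nonneg fun w hw => mul_nonneg (logNorm_pos w).le (by exact_mod_cast h w hw)

/-- … and if at EVERY bad place the sufficient label sum is `< 0`, then `¬ HStarMinus D` (the bad set is non-empty, [IUTchI] Def. 3.1 (b)).
[cite: DupuyHilado2025, §3.3, §3.6] [claim: Mochizuki2012, status: disputed] -/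
theorem not_hStarMinus_of_forall_neg (D : InitialThetaData F K Fbar E l Pb)
    (h : ∀ w ∈ (pilotDataOfK D K).S, placeSumMinus (residueChar K w) (ramIdx K w) ((pilotDataOfK D K).ordq w) l < 0) :
    ¬ HStarMinus D := by
  intro hH
  have hlt : ∑ w ∈ (pilotDataOfK D K).S,
      logNorm K w * (placeSumMinus (residueChar K w) (ramIdx K w) ((pilotDataOfK D K).ordq w) l : ℝ) < 0 :=
    Finset.sum_neg (fun w hw => mul_neg_of_pos_of_neg (logNorm_pos w) (by exact_mod_cast h w hw)) (pilotDataOfK D K).S_nonempty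
  exact absurd hH (not_le.mpr hlt)

/-- The A⁻ form implies the A⁺ form whenever `capMinusW ≤ capPlusW` at every bad place (termwise domination; the converse fails — e.g. the lamSeven
row `k = 1, l = 11, e_w = 11` of §4). [folklore] -/
theorem hStarPlus_of_hStarMinus (D : InitialThetaData F K Fbar E l Pb)
    (hcap : ∀ w ∈ (pilotDataOfK D K).S, capMinusW (residueChar K w) (ramIdx K w) ≤ capPlusW (residueChar K w) (ramIdx K w))
    (h : HStarMinus D) : HStarPlus D := by
  refine le_trans h (Finset.sum_le_sum fun w hw => mul_le_mul_of_nonneg_left ?_ (logNorm_pos w).le)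
  exact_mod_cast placeSumMinus_le_placeSumPlus (hcap w hw) _ _

end Genuine

/-! ## §3. The volume-level form and its two doors (abc-iut-rp-s2 `ObstructionSS28Places`, BY NAME) -/

section Volume

variable {T : ThetaIndex} (S : LatticeSituation T) (P : Cor312.Setting S.toSituation)
  (ρ : (∀ v : T.V, v ∈ T.Vbad → Set (S.L.StarPacket v)) → ∀ (j : T.Label) (vQ : T.VQ), Set (S.L.Packet j vQ))
  (δ : Fin T.lstar → T.VQ → ℝ)

/-- **AVERAGED INDEX-SLACK NONNEGATIVITY** (the volume-level shape of row 11, for ANY lattice situation / setting and ANY exponent binder `δ`):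
`0 ≤ PN(i ↦ Σᶠ_{v_ℚ} [δ_{i,v_ℚ} − ((i+1)² − 1)·(−qLocal_{i+1,v_ℚ})])`. With `δ = δ⁻` (a cellwise LOWER container-volume exponent) this is the A⁻ form, with
`δ = δ⁺` (UPPER) the A⁺ form. [R-H candidate, hypothesis — not a fact] [cite: Mochizuki2012, IUTchIII Prop. 3.9 (i) p. 116, Cor. 3.12 p. 173–174]
[claim: Mochizuki2012, status: disputed] -/
@[claim "Mochizuki2012" "disputed"]
def AvgIndexSlackNonneg : Prop :=
  0 ≤ processionNormalized (fun i : Fin T.lstar =>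
    ∑ᶠ vQ : T.VQ, (δ i vQ - ((((i : ℕ) + 1 : ℕ) : ℝ) ^ 2 - 1) * (-P.qLocal (Setting.labelSucc i) vQ)))

/-- **k2 DOOR, A⁻ FORM (SUFFICIENT): `AvgIndexSlackNonneg S P δ⁻ ⟹ Statement`** in print's containers reading (hull = log-shell orbit of the Θ-data at
every cell) with a cellwise LOWER container-volume bound `(i+1)²·qLocal + δ⁻ ≤ logvol(⋃_m ρ(Ψ_m·𝓘))`, `δ⁻` finitely supported, `ThetaFinite` —
abc-iut-rp-s2's `statement_of_avg_lowerIndex_sub_height_nonneg` (p454909) read on the named predicate. Target = the typed Statement of [IUTchIII]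
Cor. 3.12, NOT the hull clause S_H. [cite: Mochizuki2012, IUTchIII Cor. 3.12 p. 173–174] [claim: Mochizuki2012, status: disputed] -/
theorem statement_of_avgIndexSlackNonneg (hfin : P.ThetaFinite) (hδ : ∀ i : Fin T.lstar, (Function.support (δ i)).Finite)
    (hhull : ∀ (i : Fin T.lstar) (vQ : T.VQ),
      P.thetaHull (Setting.labelSucc i) vQ = ⋃ m : ℤ, ρ (shellSat S P.n ((S.col P.n).frobΨ m)) (Setting.labelSucc i) vQ)
    (hcont : ∀ (i : Fin T.lstar) (vQ : T.VQ),
      (((i : ℕ) + 1 : ℕ) : ℝ) ^ 2 * P.qLocal (Setting.labelSucc i) vQ + δ i vQ ≤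
        (S.D P.n).logvol _ vQ (⋃ m : ℤ, ρ (shellSat S P.n ((S.col P.n).frobΨ m)) (Setting.labelSucc i) vQ))
    (h : AvgIndexSlackNonneg S P δ) : P.Statement :=
  statement_of_avg_lowerIndex_sub_height_nonneg S P ρ δ hfin hδ hhull hcont h

/-- **A⁺ FORM IS NECESSARY: `Statement ⟹ AvgIndexSlackNonneg S P δ⁺`** with a cellwise UPPER container-volume bound
`logvol(⋃_m ρ(Ψ_m·𝓘)) ≤ (i+1)²·qLocal + δ⁺` (same reading) — abc-iut-rp-s2's `avg_upperIndex_sub_height_nonneg_of_statement`. So the A⁺ form cannot be a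
rescue hypothesis for the Statement it is implied by (k4; `ObstructionSS28Window.statement_iff_avg_cellSlack`).
[cite: Mochizuki2012, IUTchIII Cor. 3.12 p. 173–174] [claim: Mochizuki2012, status: disputed] -/
theorem avgIndexSlackNonneg_of_statement (hfin : P.ThetaFinite) (hδ : ∀ i : Fin T.lstar, (Function.support (δ i)).Finite)
    (hhull : ∀ (i : Fin T.lstar) (vQ : T.VQ),
      P.thetaHull (Setting.labelSucc i) vQ = ⋃ m : ℤ, ρ (shellSat S P.n ((S.col P.n).frobΨ m)) (Setting.labelSucc i) vQ)
    (hcont : ∀ (i : Fin T.lstar) (vQ : T.VQ),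
      (S.D P.n).logvol _ vQ (⋃ m : ℤ, ρ (shellSat S P.n ((S.col P.n).frobΨ m)) (Setting.labelSucc i) vQ) ≤
        (((i : ℕ) + 1 : ℕ) : ℝ) ^ 2 * P.qLocal (Setting.labelSucc i) vQ + δ i vQ)
    (hS : P.Statement) : AvgIndexSlackNonneg S P δ :=
  avg_upperIndex_sub_height_nonneg_of_statement S P ρ δ hfin hδ hhull hcont hS

end Volume

/-! ## §4. Evaluation lemmas at v1 rows (k1 substrate; `(p, e_w, ord_w(q), l)` with `ord_w(q) = e_w·H`) -/

/-- HEX:1:5 at `e(v|7) = 1` (`p = 7`, `e_w = 5`, `H = 2`, `l = 5`; X75 / X75i have the same integers): `placeSumMinus = 50 ≥ 0` — A⁻ HOLDS (I06⋆ POS there).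
[claim: Mochizuki2012, status: disputed] -/
theorem placeSumMinus_hex_1_5 : placeSumMinus 7 5 10 5 = 50 := by
  unfold placeSumMinus slackMinusW2l capMinusW eMulA cExp; decide

/-- HEX:1:7 at `e(v|7) = 1` (`e_w = 7`, `H = 2`, `l = 7`): `placeSumMinus = 56 ≥ 0` — A⁻ HOLDS while the I06⋆ datum is OPEN-shape (k4-separating row).
[claim: Mochizuki2012, status: disputed] -/
theorem placeSumMinus_hex_1_7 : placeSumMinus 7 7 14 7 = 56 := by
  unfold placeSumMinus slackMinusW2l capMinusW eMulA cExp; decide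

/-- HEX:2:5 at `e(v|7) = 1` (`e_w = 5`, `H = 4`, `l = 5`): `placeSumMinus = 20 ≥ 0` — A⁻ HOLDS while the I06⋆ datum is NEG (`j = 2` tame cell) —
the k4 separating cell vs I06⋆ (calibration row: `l = 5` is not HEX-admissible). [claim: Mochizuki2012, status: disputed] -/
theorem placeSumMinus_hex_2_5 : placeSumMinus 7 5 20 5 = 20 := by
  unfold placeSumMinus slackMinusW2l capMinusW eMulA cExp; decide

/-- lamSeven `k = 1`, `l = 11`, `e(v|7) = 1` (`e_w = 11`, `H = 2`; the first genuine-family row): `placeSumMinus = −220 < 0` — A⁻ FAILS (as on all 256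
lamSeven (datum, type) rows). [claim: Mochizuki2012, status: disputed] -/
theorem placeSumMinus_lamSeven_1_11 : placeSumMinus 7 11 22 11 = -220 := by
  unfold placeSumMinus slackMinusW2l capMinusW eMulA cExp; decide

/-- … while `placeSumPlus = 1210 ≥ 0` there — A⁺ HOLDS: the two forms SEPARATE on this row (A⁺ holds on 27/256 lamSeven rows: `k = 1` all 16, `k = 2` eleven).
[claim: Mochizuki2012, status: disputed] -/
theorem placeSumPlus_lamSeven_1_11 : placeSumPlus 7 11 22 11 = 1210 := by
  unfold placeSumPlus slackPlusW2l capPlusW eFloorLog cExp; decide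

/-- lamSeven `k = 2`, `l = 13`, `e(v|7) = 5` (`e_w = 65`, `H = 4`): `placeSumMinus = −13988 < 0`, a deep row. [claim: Mochizuki2012, status: disputed] -/
theorem placeSumMinus_lamSeven_2_13_ev5 : placeSumMinus 7 65 260 13 = -13988 := by
  unfold placeSumMinus slackMinusW2l capMinusW eMulA cExp; decide

/-- S-X72 (`ℚ(√7)`-type concrete datum: `p = 7`, `e_w = 2`, `H = 5`, `l = 5`): `placeSumMinus = placeSumPlus = −10 < 0` — both forms FAIL where the
licence / S_H is kernel-INHABITED (abc-iut-C p442550): the averaged shell-internal candidate is NOT necessary for S_H at the genuine bed.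
[claim: Mochizuki2012, status: disputed] -/
theorem placeSum_X72 : placeSumMinus 7 2 10 5 = -10 ∧ placeSumPlus 7 2 10 5 = -10 := by
  unfold placeSumMinus placeSumPlus slackMinusW2l slackPlusW2l capMinusW capPlusW eMulA eFloorLog cExp
  exact ⟨by decide, by decide⟩

/-! ## §5. THEOREM-GRADE k1 KILL of the A⁻ form, uniform in the local type (appended by abc-iut-rh-typ-11, round 1)

The label mass `Σ_{j ≤ l⋆} (j² − 1)` grows like `l³/24` while the sufficient capacity is at most `e_w` (`e·κ⁻ ≤ e`): so `placeSumMinus < 0` as soon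
as `l ≥ 13` and `ord_w(q) ≥ 2·e_w` (i.e. `H_w = ord_p(q_E) ≥ 2`) at ANY residue characteristic, and already for `l ≥ 11` at `p = 7`
(`5·e·κ⁻ ≤ 4e` since `a_e = ⌈e/5⌉/e ≥ 1/5`). Consequently `¬ HStarMinus D` for every initial Θ-datum with `l ≥ 13` all of whose bad places have
`ord_w(q) ≥ 2·e_w` — the whole genuine HEX family of record (`p = 7`, `H = 2k ≥ 2`, `l ≥ 11`) and every frey row with `H ≥ 2`, `l ≥ 13`, independently
of the (hypothetical) local type `e_w`. The complement (`l ≤ 11`, `H ≤ 2`, or `H = 1`) is exactly where the table shows A⁻ ≥ 0 (HEX:1:5, HEX:1:7,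
HEX:2:5, X75, DH67a1, the 126 frey place-groups with `l ∈ {7, 11}`, `H = 2`). Pure integer arithmetic; no side taken. -/

/-- `e·κ⁻ ≤ e` (the sufficient capacity never exceeds the ramification index: `c ≤ 1` at odd `p`, and `2e − 2e = 0` at `p = 2`).
[cite: Mochizuki2012, IUTchIV Prop. 1.2 (i) p. 10] -/
theorem capMinusW_le (p e : ℕ) : capMinusW p e ≤ e := by
  unfold capMinusW cExp eMulA
  split_ifs with h
  · push_cast; omega
  · push_cast; simp; positivity

/-- At `p = 7`: `5·(e·κ⁻) ≤ 4e` (`⌈e/5⌉ ≥ e/5`). [cite: Mochizuki2012, IUTchIV Prop. 1.2 (i) p. 10] -/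
theorem five_mul_capMinusW_seven_le (e : ℕ) : 5 * capMinusW 7 e ≤ 4 * e := by
  unfold capMinusW cExp eMulA
  simp only [show (7:ℕ) ≠ 2 by decide, if_false]
  have h : e ≤ 5 * ((e + 7 - 3) / (7 - 2)) := by omega
  push_cast
  omega

/-- LABEL MASS, coarse: `2n² + 2n < Σ_{i<n} ((i+1)² − 1)` for `n ≥ 6` (so `l·l⋆ <` label mass for `l ≤ 2l⋆ + 2`, `l⋆ ≥ 6`). [folklore] -/
theorem two_mul_sq_add_lt_labelMass (n : ℕ) (hn : 6 ≤ n) :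
    2 * (n : ℤ) ^ 2 + 2 * n < ∑ i ∈ Finset.range n, ((((i + 1 : ℕ) : ℤ)) ^ 2 - 1) := by
  induction n, hn using Nat.le_induction with
  | base => decide
  | succ n hn ih =>
    rw [Finset.sum_range_succ]
    push_cast at ih ⊢
    nlinarith [ih]

/-- LABEL MASS, `p = 7` form: `8n² + 8n < 5·Σ_{i<n} ((i+1)² − 1)` for `n ≥ 5`. [folklore] -/
theorem eight_mul_sq_add_lt_five_mul_labelMass (n : ℕ) (hn : 5 ≤ n) :
    8 * (n : ℤ) ^ 2 + 8 * n < 5 * ∑ i ∈ Finset.range n, ((((i + 1 : ℕ) : ℤ)) ^ 2 - 1) := by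
  induction n, hn using Nat.le_induction with
  | base => decide
  | succ n hn ih =>
    rw [Finset.sum_range_succ]
    push_cast at ih ⊢
    nlinarith [ih]

/-- **KILL (A), any residue characteristic: `l ≥ 13`, `e_w ≥ 1`, `ord_w(q) ≥ 2·e_w` (`H ≥ 2`) ⟹ `placeSumMinus p e_w ord_w(q) l < 0`.**
[cite: Mochizuki2012, IUTchIII Prop. 3.9 (i) p. 116; IUTchIV Prop. 1.2 (i) p. 10] [claim: Mochizuki2012, status: disputed] -/
theorem placeSumMinus_neg_of_thirteen_le (p e : ℕ) (ordq : ℤ) (l : ℕ) (he : 1 ≤ e) (hq : 2 * (e : ℤ) ≤ ordq) (hl : 13 ≤ l) :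
    placeSumMinus p e ordq l < 0 := by
  rw [placeSumMinus_eq]
  set n := (l - 1) / 2 with hn
  have hn6 : 6 ≤ n := by omega
  have hl2 : (l : ℤ) ≤ 2 * n + 2 := by omega
  have hmass := two_mul_sq_add_lt_labelMass n hn6
  have hcap := capMinusW_le p e
  have he' : (1 : ℤ) ≤ e := by exact_mod_cast he
  have hn0 : (0 : ℤ) ≤ n := by positivity
  set M := ∑ i ∈ Finset.range n, ((((i + 1 : ℕ) : ℤ)) ^ 2 - 1) with hM
  have hM0 : 0 < M := by nlinarith
  have h1 : 2 * (l : ℤ) * capMinusW p e * n ≤ 2 * (2 * n + 2) * e * n := by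
    have : (l : ℤ) * capMinusW p e ≤ (2 * n + 2) * e := by
      by_cases hc : 0 ≤ capMinusW p e
      · exact mul_le_mul hl2 hcap hc (by positivity)
      · push Not at hc
        have : (l : ℤ) * capMinusW p e ≤ 0 := mul_nonpos_of_nonneg_of_nonpos (by positivity) hc.le
        nlinarith
    nlinarith
  have h2 : 2 * (2 * (n : ℤ) + 2) * e * n < 2 * e * M := by nlinarith
  have h3 : 2 * (e : ℤ) * M ≤ M * ordq := by nlinarith
  linarith

/-- **KILL (B), `p = 7`: `l ≥ 11`, `e_w ≥ 1`, `ord_w(q) ≥ 2·e_w` ⟹ `placeSumMinus 7 e_w ord_w(q) l < 0`** — covers the `l = 11` rows of the HEX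
family of record (`lamSeven k=1 l=11`, all eight local types) uniformly in `e_w`. [cite: Mochizuki2012, IUTchIII Prop. 3.9 (i) p. 116; IUTchIV Prop. 1.2 (i) p. 10]
[claim: Mochizuki2012, status: disputed] -/
theorem placeSumMinus_seven_neg_of_eleven_le (e : ℕ) (ordq : ℤ) (l : ℕ) (he : 1 ≤ e) (hq : 2 * (e : ℤ) ≤ ordq) (hl : 11 ≤ l) :
    placeSumMinus 7 e ordq l < 0 := by
  rw [placeSumMinus_eq]
  set n := (l - 1) / 2 with hn
  have hn5 : 5 ≤ n := by omega
  have hl2 : (l : ℤ) ≤ 2 * n + 2 := by omega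
  have hmass := eight_mul_sq_add_lt_five_mul_labelMass n hn5
  have hcap := five_mul_capMinusW_seven_le e
  have he' : (1 : ℤ) ≤ e := by exact_mod_cast he
  have hn0 : (0 : ℤ) ≤ n := by positivity
  set M := ∑ i ∈ Finset.range n, ((((i + 1 : ℕ) : ℤ)) ^ 2 - 1) with hM
  have hM0 : 0 < M := by nlinarith
  have h1 : 5 * (2 * (l : ℤ) * capMinusW 7 e * n) ≤ 2 * (2 * n + 2) * (4 * e) * n := by
    have : (l : ℤ) * (5 * capMinusW 7 e) ≤ (2 * n + 2) * (4 * e) := by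
      by_cases hc : 0 ≤ capMinusW 7 e
      · exact mul_le_mul hl2 hcap (by linarith) (by positivity)
      · push Not at hc
        have : (l : ℤ) * (5 * capMinusW 7 e) ≤ 0 := mul_nonpos_of_nonneg_of_nonpos (by positivity) (by linarith)
        nlinarith
    nlinarith
  have h2 : 2 * (2 * (n : ℤ) + 2) * (4 * e) * n < 2 * e * (5 * M) := by nlinarith
  have h3 : 2 * (e : ℤ) * (5 * M) ≤ 5 * (M * ordq) := by nlinarith
  linarith

section GenuineKill

variable {F K Fbar : Type} [Field F] [NumberField F] [Field K] [NumberField K] [Algebra F K] [Field Fbar]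
  [Algebra F Fbar] [Algebra K Fbar] {E : WeierstrassCurve F} [E.IsElliptic] {l : ℕ} {Pb : BadPlacePredicates K}

/-- **H⋆₁₁ (A⁻) FAILS AT EVERY GENUINE DATUM WITH `l ≥ 13` AND `ord_w(q) ≥ 2·e_w` AT ALL BAD PLACES** (`H_w = ord_p(q_E) ≥ 2`; any residue
characteristics, any local types): the theorem-grade form of the k1 kill on the genuine families of record (HEX `k ≥ 1`, `l ≥ 13`; frey rows with
`H ≥ 2`, `l ≥ 13`). [cite: Mochizuki2012, IUTchI Def. 3.1 (b)(c) p. 61; IUTchIII Prop. 3.9 (i) p. 116] [claim: Mochizuki2012, status: disputed] -/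
theorem not_hStarMinus_of_thirteen_le (D : InitialThetaData F K Fbar E l Pb) (hl : 13 ≤ l)
    (hH : ∀ w ∈ (pilotDataOfK D K).S, 2 * (ramIdx K w : ℤ) ≤ (pilotDataOfK D K).ordq w) : ¬ HStarMinus D :=
  not_hStarMinus_of_forall_neg D fun w hw =>
    placeSumMinus_neg_of_thirteen_le _ _ _ _ (Nat.one_le_iff_ne_zero.mpr (ramIdx_ne_zero K w)) (hH w hw) hl

/-- **… and already for `l ≥ 11` when every bad place lies over `7`** (the HEX family of record: `p = 7`, `H = 2k ≥ 2`, `l ≥ 11`, every local type).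
[cite: Mochizuki2012, IUTchI Def. 3.1 (b)(c) p. 61; IUTchIII Prop. 3.9 (i) p. 116] [claim: Mochizuki2012, status: disputed] -/
theorem not_hStarMinus_seven_of_eleven_le (D : InitialThetaData F K Fbar E l Pb) (hl : 11 ≤ l)
    (h7 : ∀ w ∈ (pilotDataOfK D K).S, residueChar K w = 7)
    (hH : ∀ w ∈ (pilotDataOfK D K).S, 2 * (ramIdx K w : ℤ) ≤ (pilotDataOfK D K).ordq w) : ¬ HStarMinus D :=
  not_hStarMinus_of_forall_neg D fun w hw => by
    rw [h7 w hw]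
    exact placeSumMinus_seven_neg_of_eleven_le _ _ _ (Nat.one_le_iff_ne_zero.mpr (ramIdx_ne_zero K w)) (hH w hw) hl

end GenuineKill

end Summit.ABC.IUTFork.Repair.RHAvgSlackNonneg

end
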